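import Literature.Barriers.ValiantsHypothesis.MonotoneGapPermanentLower
import Literature.Computability.AlgebraicComplexity.GateQuotients

/-!
# ValiantsHypothesis / SummationBits — support counting for `PositiveWitnessBound` (Theorem A)

Helper file for item `stmt-ValiantsHypothesis-10488` (`PositiveWitnessBound`, route `SummationBits`).

The combinatorial core of the upper bound `|supp g| ≤ 2^(n·log₂log₂n + O(n))` for a polynomial
`g` with `supp g ⊆ supp per_n` computed by a polynomial-size circuit over the semiring `ℝ≥0`:
a support count along the `×`-balanced gate-quotient expansion of a homogeneous circuit
certificate (`DepthReduction.HomCircuit.expandAtom`, the tree's Valiant–Skyum–Berkowitz–Rackoff /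
Tavenas machinery of `GateQuotients.lean`).

* Positivity calculus over `ℝ≥0` for lists (`card_support_list_sum_le`,
  `card_support_list_prod_le`, `exists_shift_of_prod_ne_zero`, on top of
  `JerrumSnir.mem_support_list_sum` / `support_mul_eq` of `MonotoneGapParseTrees.lean`): no cancellation, so a factor of a
  nonzero product whose monomials extend (by a fixed monomial) to permanent monomials has the
  same property.
* The leaf bound `card_support_le_pow_of_shift`: such an "extendable" polynomial of total degree
  `≤ D ≤ D₀` has at most `D₀ ^ D` monomials (Jerrum–Snir's partition argument,
  `JerrumSnir.card_le_factorial_of_add_mem`: the monomials are perfect matchings on a fixed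
  `deg × deg` block).
* The potential arithmetic `pot_sum_succ_le`: with `pot x = 0` for `x ≤ D₀` and
  `pot x = 2x/D₀ - 1` for `x > D₀`, every split of `D > D₀` into parts of size `≤ D/2` loses at
  least one unit of potential — this pays for the `(#nodes)²` terms of one expansion step.
* `card_support_aval_le`: for every atom (node value or gate quotient) of a homogeneous circuit
  certificate over `ℝ≥0` whose value is extendable, `|supp| ≤ (#ι·#ι)^(pot D) · D₀^D`, `D` its
  formal degree — by strong induction on `D` along `expandAtom`.
-/

namespace Summit.ValiantsHypothesis.ValiantsHypothesis.Theorems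

-- every Theorems file of this summit lives in `Summit.ValiantsHypothesis.ValiantsHypothesis.…`
-- (summit = problem name), which core's `dupNamespace` linter reports on each declaration
set_option linter.dupNamespace false

namespace PositiveWitness

open MvPolynomial Literature.Computability.AlgebraicComplexity
open Literature.Computability.AlgebraicComplexity.DepthReduction
open Literature.Barriers.ValiantsHypothesis
open scoped NNReal Pointwise

/-! ### Positivity calculus for lists over `ℝ≥0` -/

section Lists

variable {σ : Type*} [DecidableEq σ]

/-- The number of monomials of a list sum is at most the sum of the numbers of monomials.
[folklore] -/
theorem card_support_list_sum_le (l : List (MvPolynomial σ ℝ≥0)) :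
    l.sum.support.card ≤ (l.map fun f => f.support.card).sum := by
  induction l with
  | nil => simp
  | cons f l ih =>
    rw [List.sum_cons, List.map_cons, List.sum_cons, JerrumSnir.support_add_eq]
    exact (Finset.card_union_le _ _).trans (Nat.add_le_add_left ih _)

/-- The number of monomials of a list product is at most the product of the numbers of monomials.
[folklore] -/
theorem card_support_list_prod_le (l : List (MvPolynomial σ ℝ≥0)) :
    l.prod.support.card ≤ (l.map fun f => f.support.card).prod := by
  induction l with
  | nil => simp [support_one]
  | cons f l ih =>
    rw [List.prod_cons, List.map_cons, List.prod_cons]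
    exact (Finset.card_le_card (support_mul f l.prod)).trans
      ((Finset.card_add_le).trans (Nat.mul_le_mul_left _ ih))

/-- **Propagation of extendability through a nonzero product.** If the product of a list of
polynomials over `ℝ≥0` is nonzero and each of its monomials, shifted by `e`, lies in a set `S` of
monomials, then every factor has a shift with the same property (shift by `e` plus one monomial
of each of the other factors: no cancellation over `ℝ≥0`). [folklore] -/
theorem exists_shift_of_prod_ne_zero (S : Finset (σ →₀ ℕ)) :
    ∀ (l : List (MvPolynomial σ ℝ≥0)) (e : σ →₀ ℕ), l.prod ≠ 0 →
      (∀ m ∈ l.prod.support, m + e ∈ S) →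
        ∀ f ∈ l, ∃ e' : σ →₀ ℕ, ∀ m ∈ f.support, m + e' ∈ S := by
  intro l
  induction l with
  | nil => intro e _ _ f hf; simp at hf
  | cons f l ih =>
    intro e hne h g hg
    rw [List.prod_cons] at hne h
    have hf0 : f ≠ 0 := fun h0 => hne (by rw [h0, zero_mul])
    have hl0 : l.prod ≠ 0 := fun h0 => hne (by rw [h0, mul_zero])
    obtain ⟨m₀, hm₀⟩ := support_nonempty.2 hf0
    obtain ⟨m₁, hm₁⟩ := support_nonempty.2 hl0
    rw [List.mem_cons] at hg
    rcases hg with rfl | hg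
    · refine ⟨m₁ + e, fun m hm => ?_⟩
      rw [← add_assoc]
      apply h
      rw [JerrumSnir.support_mul_eq]
      exact Finset.add_mem_add hm hm₁
    · refine ih (m₀ + e) hl0 (fun m' hm' => ?_) g hg
      rw [← add_assoc, add_comm m' m₀]
      apply h
      rw [JerrumSnir.support_mul_eq]
      exact Finset.add_mem_add hm₀ hm'

/-- Products of powers along a list collect into powers of sums. [folklore] -/
theorem prod_map_pow_mul_pow {α : Type*} (M N : ℕ) (f g : α → ℕ) (l : List α) :
    (l.map fun x => M ^ f x * N ^ g x).prod = M ^ (l.map f).sum * N ^ (l.map g).sum := by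
  induction l with
  | nil => simp
  | cons x l ih =>
    simp only [List.map_cons, List.prod_cons, List.sum_cons, ih]
    ring

end Lists

/-! ### The potential arithmetic -/

section Potential

/-- Bookkeeping for the potential: the sum of the potentials plus the number of large parts is at
most `2·(Σ parts)/D₀`. [folklore] -/
theorem pot_sum_add_count_le {D₀ : ℕ} (hD₀ : 1 ≤ D₀) (L : List ℕ) :
    (L.map fun x => if x ≤ D₀ then 0 else 2 * x / D₀ - 1).sum + L.countP (fun x => D₀ < x) ≤
      2 * L.sum / D₀ := by
  induction L with
  | nil => simp
  | cons x L ih =>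
    rw [List.map_cons, List.sum_cons, List.sum_cons, List.countP_cons]
    by_cases hx : x ≤ D₀
    · rw [if_pos hx]
      have : ¬ D₀ < x := not_lt.2 hx
      simp only [this, decide_false, Bool.false_eq_true, ↓reduceIte, Nat.add_zero, zero_add]
      exact ih.trans (Nat.div_le_div_right (by omega))
    · rw [if_neg hx]
      have hlt : D₀ < x := not_le.1 hx
      simp only [hlt, decide_true, ↓reduceIte]
      have h1 : 2 * x / D₀ + 2 * L.sum / D₀ ≤ 2 * (x + L.sum) / D₀ := by
        rw [Nat.mul_add]; exact Nat.add_div_le_add_div _ _ _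
      have h2 : 2 ≤ 2 * x / D₀ := (Nat.le_div_iff_mul_le hD₀).2 (by omega)
      omega

/-- Bookkeeping for the potential: each large part of size `≤ D/2` has potential `≤ D/D₀ - 1`,
small parts have potential `0`. [folklore] -/
theorem pot_sum_le_count_mul (D₀ D : ℕ) (L : List ℕ) (hhalf : ∀ x ∈ L, 2 * x ≤ D) :
    (L.map fun x => if x ≤ D₀ then 0 else 2 * x / D₀ - 1).sum ≤
      L.countP (fun x => D₀ < x) * (D / D₀ - 1) := by
  induction L with
  | nil => simp
  | cons x L ih =>
    have ih' := ih fun y hy => hhalf y (List.mem_cons_of_mem x hy)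
    have hxD := hhalf x (by simp)
    rw [List.map_cons, List.sum_cons, List.countP_cons]
    by_cases hx : x ≤ D₀
    · rw [if_pos hx]
      have : ¬ D₀ < x := not_lt.2 hx
      simp only [this, decide_false, Bool.false_eq_true, ↓reduceIte, Nat.add_zero, zero_add]
      exact ih'
    · rw [if_neg hx]
      have hlt : D₀ < x := not_le.1 hx
      simp only [hlt, decide_true, ↓reduceIte]
      have h1 : 2 * x / D₀ ≤ D / D₀ := Nat.div_le_div_right hxD
      rw [Nat.add_mul, one_mul]
      omega

/-- **The potential pays for one expansion step.** If `D > D₀ ≥ 1` is split into parts of size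
`≤ D/2`, the potentials of the parts sum to at most the potential of `D` minus one. [folklore] -/
theorem pot_sum_succ_le {D₀ D : ℕ} (hD₀ : 1 ≤ D₀) (hD : D₀ < D) (L : List ℕ) (hsum : L.sum = D)
    (hhalf : ∀ x ∈ L, 2 * x ≤ D) :
    (L.map fun x => if x ≤ D₀ then 0 else 2 * x / D₀ - 1).sum + 1 ≤ 2 * D / D₀ - 1 := by
  have h1 := pot_sum_add_count_le hD₀ L
  have h2 := pot_sum_le_count_mul D₀ D L hhalf
  rw [hsum] at h1
  have hq1 : 1 ≤ D / D₀ := (Nat.le_div_iff_mul_le hD₀).2 (by omega)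
  have hq2 : D / D₀ + D / D₀ ≤ 2 * D / D₀ := by
    rw [two_mul]; exact Nat.add_div_le_add_div _ _ _
  set k := L.countP (fun x => D₀ < x) with hk
  set s := (L.map fun x => if x ≤ D₀ then 0 else 2 * x / D₀ - 1).sum with hs
  rcases Nat.lt_or_ge k 2 with hk2 | hk2
  · have hs' : s ≤ D / D₀ - 1 := by
      interval_cases k
      · simp only [zero_mul] at h2; omega
      · simp only [one_mul] at h2; omega
    omega
  · omega

end Potential

/-! ### The leaf bound (Jerrum–Snir's partition argument) -/

section Leaf

variable {n : ℕ}

/-- **Leaf bound.** A polynomial over `ℝ≥0` all of whose monomials extend, by one fixed monomial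
`e`, to monomials of `per_n`, and of total degree `≤ D ≤ D₀` (`D₀ ≥ 1`), has at most `D₀ ^ D`
monomials: they are perfect matchings on one `d × d` block, `d ≤ D`, hence at most
`d! ≤ d^d ≤ D₀^D` of them. [cite: JerrumSnir1982, §4.3 (p. 887–888)] -/
theorem card_support_le_pow_of_shift {D₀ D : ℕ} (hD₀ : 1 ≤ D₀)
    {f : MvPolynomial (Fin n × Fin n) ℝ≥0} {e : Fin n × Fin n →₀ ℕ}
    (he : ∀ m ∈ f.support, m + e ∈ (perPoly (Fin n) ℝ≥0).support)
    (hdeg : f.totalDegree ≤ D) (hD : D ≤ D₀) : f.support.card ≤ D₀ ^ D := by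
  rcases f.support.eq_empty_or_nonempty with h0 | ⟨a₀, ha₀⟩
  · rw [h0]; simp
  · have hA : ∀ a ∈ f.support, ∃ ρ : Equiv.Perm (Fin n), a + e = permMonomial ρ := by
      intro a ha
      obtain ⟨ρ, hρ⟩ := (JerrumSnir.mem_support_perPoly ℝ≥0).1 (he a ha)
      exact ⟨ρ, hρ.symm⟩
    obtain ⟨hcard, -⟩ := JerrumSnir.card_le_factorial_of_add_mem hA ha₀
    have hdeg₀ : a₀.degree ≤ D := by
      refine le_trans ?_ ((le_totalDegree ha₀).trans hdeg)
      rw [Finsupp.degree_apply]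
      rfl
    calc f.support.card ≤ (a₀.degree).factorial := hcard
      _ ≤ a₀.degree ^ a₀.degree := Nat.factorial_le_pow _
      _ ≤ D₀ ^ a₀.degree := Nat.pow_le_pow_left (hdeg₀.trans hD) _
      _ ≤ D₀ ^ D := Nat.pow_le_pow_right hD₀ hdeg₀

end Leaf

/-! ### Support counting along the `×`-balanced expansion -/

section Count

variable {n : ℕ} {ι : Type*} [Fintype ι] [DecidableEq ι]
  (H : HomCircuit ℝ≥0 (Fin n × Fin n) ι)

/-- **Support count for extendable atoms.** For a homogeneous circuit certificate over `ℝ≥0` on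
the variables `x_{ij}` of `per_n` and `D₀ ≥ 1`: if the value of an atom `a` (a node value or a
gate quotient) of formal degree `D` is extendable (its monomials, shifted by a fixed monomial,
are monomials of `per_n`), then it has at most `(#ι·#ι)^(pot D) · D₀^D` monomials, where
`pot D = 0` for `D ≤ D₀` and `pot D = 2D/D₀ - 1` otherwise. Strong induction on `D`: leaves by
`card_support_le_pow_of_shift`; for `D > D₀` expand `a` (`HomCircuit.expandAtom`, at most `#ι·#ι`
terms, each a product of atoms of formal degree `≤ D/2` and total formal degree `D`), propagate
extendability to the atoms of every nonzero term, and pay the number of terms with the unit of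
potential of `pot_sum_succ_le`. [folklore] -/
theorem card_support_aval_le {D₀ : ℕ} (hD₀ : 1 ≤ D₀) :
    ∀ (D : ℕ) (a : HomCircuit.Atom ι), H.adeg a = D →
      (∃ e : Fin n × Fin n →₀ ℕ, ∀ m ∈ (H.aval a).support, m + e ∈ (perPoly (Fin n) ℝ≥0).support) →
        (H.aval a).support.card ≤
          (Fintype.card ι * Fintype.card ι) ^ (if D ≤ D₀ then 0 else 2 * D / D₀ - 1) * D₀ ^ D := by
  intro D
  induction D using Nat.strong_induction_on with
  | _ D ih =>
    rintro a haD ⟨e, he⟩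
    have hι : 1 ≤ Fintype.card ι := by
      cases a with
      | node ν => exact Fintype.card_pos_iff.2 ⟨ν⟩
      | quot ν μ => exact Fintype.card_pos_iff.2 ⟨ν⟩
    set M₂ := Fintype.card ι * Fintype.card ι with hM₂def
    have hM₂ : 1 ≤ M₂ := Nat.one_le_iff_ne_zero.2 (Nat.mul_ne_zero (by omega) (by omega))
    by_cases hD : D ≤ D₀
    · rw [if_pos hD, pow_zero, one_mul]
      exact card_support_le_pow_of_shift hD₀ he ((H.totalDegree_aval_le a).trans haD.le) hD
    rw [if_neg hD]
    have hD' : D₀ < D := not_le.1 hD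
    have h2 : 2 ≤ H.adeg a := by omega
    have hsum := H.expandAtom_sum h2
    -- the bound for one term of the expansion
    have hterm : ∀ T ∈ H.expandAtom a,
        (H.tval T).support.card ≤ M₂ ^ (2 * D / D₀ - 1 - 1) * D₀ ^ D := by
      intro T hT
      by_cases h0 : H.tval T = 0
      · rw [h0]; simp
      have hTsub : (H.tval T).support ⊆ (H.aval a).support := by
        rw [← hsum]
        exact fun m hm =>
          JerrumSnir.mem_support_list_sum.2 ⟨H.tval T, List.mem_map.2 ⟨T, hT, rfl⟩, hm⟩
      have hext : ∀ b ∈ T, ∃ e' : Fin n × Fin n →₀ ℕ,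
          ∀ m ∈ (H.aval b).support, m + e' ∈ (perPoly (Fin n) ℝ≥0).support := by
        intro b hb
        exact exists_shift_of_prod_ne_zero _ (T.map H.aval) e h0
          (fun m hm => he m (hTsub hm)) (H.aval b) (List.mem_map.2 ⟨b, hb, rfl⟩)
      have htdeg : (T.map H.adeg).sum = D := haD ▸ H.expandAtom_tdeg hT
      have hhalf : ∀ x ∈ T.map H.adeg, 2 * x ≤ D := by
        intro x hx
        obtain ⟨b, hb, rfl⟩ := List.mem_map.1 hx
        exact haD ▸ H.expandAtom_half hT b hb
      have hpot := pot_sum_succ_le hD₀ hD' (T.map H.adeg) htdeg hhalf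
      calc (H.tval T).support.card
          ≤ ((T.map H.aval).map fun f => f.support.card).prod := card_support_list_prod_le _
        _ = (T.map fun b => (H.aval b).support.card).prod := by rw [List.map_map]; rfl
        _ ≤ (T.map fun b => M₂ ^ (if H.adeg b ≤ D₀ then 0 else 2 * H.adeg b / D₀ - 1) *
              D₀ ^ H.adeg b).prod := by
            apply List.prod_le_prod'
            intro b hb
            have hlt : H.adeg b < D := by
              have := H.expandAtom_half hT b hb
              omega
            exact ih (H.adeg b) hlt b rfl (hext b hb)
        _ = M₂ ^ (T.map fun b => if H.adeg b ≤ D₀ then 0 else 2 * H.adeg b / D₀ - 1).sum *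
              D₀ ^ (T.map H.adeg).sum := prod_map_pow_mul_pow _ _ _ _ _
        _ ≤ M₂ ^ (2 * D / D₀ - 1 - 1) * D₀ ^ D := by
            rw [htdeg]
            apply Nat.mul_le_mul_right
            apply Nat.pow_le_pow_right hM₂
            have : (T.map fun b => if H.adeg b ≤ D₀ then 0 else 2 * H.adeg b / D₀ - 1) =
                (T.map H.adeg).map fun x => if x ≤ D₀ then 0 else 2 * x / D₀ - 1 := by
              rw [List.map_map]; rfl
            rw [this]
            omega
    -- summing over the at most `M₂` terms
    have hlen := H.length_expandAtom_le a
    have h2D : 2 ≤ 2 * D / D₀ := (Nat.le_div_iff_mul_le hD₀).2 (by omega)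
    calc (H.aval a).support.card
        = (((H.expandAtom a).map H.tval).sum).support.card := by rw [hsum]
      _ ≤ (((H.expandAtom a).map H.tval).map fun f => f.support.card).sum :=
          card_support_list_sum_le _
      _ ≤ (((H.expandAtom a).map H.tval).map fun f => f.support.card).length •
            (M₂ ^ (2 * D / D₀ - 1 - 1) * D₀ ^ D) := by
          apply List.sum_le_card_nsmul
          intro x hx
          rw [List.map_map] at hx
          obtain ⟨T, hT, rfl⟩ := List.mem_map.1 hx
          exact hterm T hT
      _ ≤ M₂ * (M₂ ^ (2 * D / D₀ - 1 - 1) * D₀ ^ D) := by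
          rw [List.length_map, List.length_map, smul_eq_mul]
          exact Nat.mul_le_mul_right _ hlen
      _ = M₂ ^ (2 * D / D₀ - 1) * D₀ ^ D := by
          rw [← mul_assoc, ← pow_succ']
          congr 2
          omega

end Count

end PositiveWitness

end Summit.ValiantsHypothesis.ValiantsHypothesis.Theorems
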